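import Literature.MathematicalPhysics.QuantumChemistry.RelaxationEnergyAttained
import HarnessLib

/-!
# Symmetry of the variational 2-RDM programme: relabelling covariance and the group average

Topic `Literature/MathematicalPhysics/QuantumChemistry`; companion of `VariationalRDMRelaxation.lean`
(the DQG-feasible set `IsDQGFeasible N γ Γ`, the functional `rdmEnergy`),
`ThreeIndexRelaxationBound.lean` (`IsDQGT1T2PrimeFeasible`), `RelaxationEnergyHierarchy.lean`
(the value `E_PQG = pqgEnergy`) and `RelaxationEnergyAttained.lean` (the value is a minimum).
Source: K. Gatermann, P. A. Parrilo, *Symmetry groups, semidefinite programs, and sums of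
squares*, J. Pure Appl. Algebra 192 (2004) 95–128, §3:

  Definition 3.1. "a semidefinite optimization problem … is called invariant with respect to `σ`,
  if (i) the set of feasible matrices is invariant with respect to `σ`; (ii) the cost function
  `F(X) = ⟨C, X⟩` is invariant with respect to `σ`."
  Theorem 3.3. "Given an orthogonal linear representation `σ : G → Aut(S^n)` of a finite group
  `G` consider a semidefinite program which is invariant with respect to `σ`. Then the optimal
  values `F`, `F_σ` of the original semidefinite program and the fixed-point restricted
  semidefinite program are equal." Proof: "Define the 'group average' (or Reynolds operator)
  `X_σ := (1/|G|) Σ_{g ∈ G} σ(g)(X₁)` … `X_σ` is a feasible point … by construction `X_σ ∈ 𝓕` …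
  the cost function has the same value for `X₁` and `X_σ` by condition (ii)."

applied to the variational 2-RDM programme, whose symmetry group acts by RELABELLING the
spin-orbital index set (`γ ↦ γ ∘ (e × e)`, `Γ ↦ Γ ∘ ((e × e) × (e × e))` for a bijection `e` —
a permutation representation, orthogonal). This file proves:

* CONDITION (i) for every relabelling: Mazziotti's `Q`- and `G`-maps, the `T1`/`T2`/`T2′`
  functionals and the linear rows are covariant under `e : κ ≃ ι` (`qMap_submatrix`,
  `gMap_submatrix`, `t1Map_submatrix`, `t2PrimeMap_submatrix`), hence
  **`IsDQGFeasible.submatrix`**, **`IsDQGT1T2PrimeFeasible.submatrix`**: the feasible sets are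
  invariant under ALL relabellings of the one-particle basis; the `S_z`-sector sets are invariant
  under spin-preserving orbital relabellings `Orb.mapEquiv f` (`IsDQGFeasibleSector.submatrix_mapEquiv`)
  and the spin flip `Orb.spinSwap` exchanges the sectors `(a, b) ↔ (b, a)`
  (`IsDQGFeasibleSector.submatrix_spinSwap`);
* CONDITION (ii) for the symmetries the certified-quantum-chemistry cell uses: the energy functional
  is invariant under an orbital relabelling `f : Λ ≃ Λ` that preserves the integral tables
  (`rdmEnergy_submatrix_mapEquiv`, e.g. the cyclic / dihedral site symmetry of a ring) and under
  the spin flip for spin-free integrals (`rdmEnergy_submatrix_spinSwap`);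
* CONVEXITY and the GROUP AVERAGE: for a finite group `G` represented by relabellings
  `σ : G →* Equiv.Perm ι`, the Reynolds average `(1/|G|) Σ_g (γ, Γ) ∘ σ(g)` of a feasible pair
  is feasible (**`IsDQGFeasible.average`**), `σ`-invariant (`average_one_submatrix`,
  `average_two_submatrix`), and has the
  same energy when the functional is `σ`-invariant (`rdmEnergy_average`);
* CONVEXITY of the sector set (`IsDQGFeasibleSector.sum_smul`) and of the three-index sets
  (`t1Map_sum_smul` affine, `t2Map_sum_smul` / `t2PrimeMap_sum_smul` linear,
  `IsDQGT1T2PrimeFeasible.sum_smul`, `IsDQGT1T2PrimeFeasibleSector.sum_smul`), and AFFINITY of the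
  functional (`rdmEnergy_add`, `rdmEnergy_smul`, `rdmEnergy_sum_smul`);
* THEOREM 3.3 for `E_PQG`: under (ii), **`le_pqgEnergy_iff_invariant`** — a number lies below
  `E(γ, Γ)` on the whole DQG-feasible set iff it does so on the `σ`-INVARIANT feasible pairs (the
  fixed-point restricted programme has the same value), and
  **`exists_invariant_isDQGFeasible_rdmEnergy_eq_pqgEnergy`** — the minimum `E_PQG` is attained
  at a `σ`-invariant feasible pair ("when convexity is present … the search for solutions can
  always be restricted a priori to the fixed-point subspace"); the same for the `S_z`-SECTOR programme `E_PQG(a, b)`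
  under an orbital symmetry group `ρ : G →* Equiv.Perm Λ` of the integrals
  (**`le_pqgSectorEnergy_iff_invariant`**,
  **`exists_invariant_isDQGFeasibleSector_rdmEnergy_eq_pqgSectorEnergy`**, with
  `IsDQGFeasibleSector.average` and `rdmEnergy_submatrix_mapPerm`), and — primed versions — under
  ANY relabelling group preserving the sector set and the energy (`IsDQGFeasibleSector.average'`,
  `le_pqgSectorEnergy_iff_invariant'`, `exists_invariant_isDQGFeasibleSector_rdmEnergy_eq_pqgSectorEnergy'`),
  which for `N_α = N_β` admits the spin flip (`IsDQGFeasibleSector.submatrix_spinSwap_self`) — the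
  abstract form of the `M = 0` spin-flip quotient's losslessness; and the `PQGT1T2′` rungs
  `E_PQGT1T2′` / `E_PQGT1T2′(a, b)` (`IsDQGT1T2PrimeFeasible.average`, `le_pqgT1T2pEnergy_iff_invariant`,
  `exists_invariant_isDQGT1T2PrimeFeasible_rdmEnergy_eq_pqgT1T2pEnergy`,
  `IsDQGT1T2PrimeFeasibleSector.submatrix_mapEquiv` / `.average'`, `le_pqgT1T2pSectorEnergy_iff_invariant`,
  `exists_invariant_isDQGT1T2PrimeFeasibleSector_rdmEnergy_eq_pqgT1T2pSectorEnergy`).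

This is the abstract (primal) counterpart of the symmetry reductions used when the cell's SDP
instances are block-diagonalised by orbital permutations or quotiented by the spin flip: the
relaxation itself, not only the set of `N`-representable pairs, is invariant, so nothing is lost
by restricting to symmetric moments. Everything is PROVED (0 sorry); no definitions (the average
is written out), no named facts. NOT here: the block-diagonalisation of invariant matrices
(Gatermann–Parrilo §4–5, representation theory), the dual (sum-of-squares) side, and any
statement about a particular molecule's symmetry group.

## References
* K. Gatermann, P. A. Parrilo, *Symmetry groups, semidefinite programs, and sums of squares*,
  J. Pure Appl. Algebra 192 (2004) 95–128, §3 Definition 3.1, Theorem 3.3 and its proof (held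
  copy `paper:arxiv-math_0211450`, PDF pp. 7–8). [cite: GatermannParrilo2004, §3 Def. 3.1, Thm. 3.3]
* D. A. Mazziotti, *Variational two-electron reduced-density-matrix theory*, in: Reduced-Density-
  Matrix Mechanics, Adv. Chem. Phys. 134 (Wiley, 2007) 21–59, §II.B eqs. (14)–(15) (the maps
  relabelled here), §II.G eqs. (107)–(111) (the programme as an SDP). [cite: Mazziotti2007RDMChapter, §II.B eqs. (14)-(15); §II.G]
* M. Nakata et al., J. Chem. Phys. 128 (2008) 164113, §II.A (`T1`, `T2′`). [cite: NakataEtAl2008, §II.A]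
-/

noncomputable section

namespace Literature.MathematicalPhysics.QuantumChemistry

open Matrix Finset Literature.MathematicalPhysics.QuantumLattice
open scoped ComplexOrder

/-! ### Condition (i): the maps and the feasible sets are covariant under relabelling -/

section Relabel

variable {ι κ : Type*} [LinearOrder ι] [Fintype ι] [LinearOrder κ] [Fintype κ]

omit [Fintype ι] [Fintype κ] in
/-- **The `Q`-map is covariant under relabelling** of the one-particle index set:
`Q(γ ∘ e, Γ ∘ e) = Q(γ, Γ) ∘ e` (Mazziotti eq. (14) is written in terms of Kronecker deltas and
entries only). [cite: Mazziotti2007RDMChapter, §II.B eq. (14)] -/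
theorem qMap_submatrix (e : κ ≃ ι) (γ : Matrix ι ι ℂ) (Γ : Matrix (ι × ι) (ι × ι) ℂ) :
    qMap (γ.submatrix e e) (Γ.submatrix (Prod.map e e) (Prod.map e e)) =
      (qMap γ Γ).submatrix (Prod.map e e) (Prod.map e e) := by
  ext ⟨i, j⟩ ⟨k, l⟩
  simp only [submatrix_apply, Prod.map_apply, qMap_apply, e.injective.eq_iff]

omit [Fintype ι] [Fintype κ] in
/-- **The `G`-map is covariant under relabelling**: `G(γ ∘ e, Γ ∘ e) = G(γ, Γ) ∘ e`.
[cite: Mazziotti2007RDMChapter, §II.B eq. (15)] -/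
theorem gMap_submatrix (e : κ ≃ ι) (γ : Matrix ι ι ℂ) (Γ : Matrix (ι × ι) (ι × ι) ℂ) :
    gMap (γ.submatrix e e) (Γ.submatrix (Prod.map e e) (Prod.map e e)) =
      (gMap γ Γ).submatrix (Prod.map e e) (Prod.map e e) := by
  ext ⟨i, j⟩ ⟨k, l⟩
  simp only [submatrix_apply, Prod.map_apply, gMap_apply, e.injective.eq_iff]

omit [Fintype ι] [Fintype κ] in
/-- The `T1` functional is covariant under relabelling. [cite: NakataEtAl2008, §II.A] -/
theorem t1Map_submatrix (e : κ ≃ ι) (γ : Matrix ι ι ℂ) (Γ : Matrix (ι × ι) (ι × ι) ℂ) :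
    t1Map (γ.submatrix e e) (Γ.submatrix (Prod.map e e) (Prod.map e e)) =
      (t1Map γ Γ).submatrix (Prod.map e (Prod.map e e)) (Prod.map e (Prod.map e e)) := by
  ext ⟨i, j, k⟩ ⟨l, m, n⟩
  simp only [submatrix_apply, Prod.map_apply, t1Map_apply, e.injective.eq_iff]

omit [Fintype ι] [Fintype κ] in
/-- The `T2` functional is covariant under relabelling. [cite: NakataEtAl2008, §II.A] -/
theorem t2Map_submatrix (e : κ ≃ ι) (γ : Matrix ι ι ℂ) (Γ : Matrix (ι × ι) (ι × ι) ℂ) :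
    t2Map (γ.submatrix e e) (Γ.submatrix (Prod.map e e) (Prod.map e e)) =
      (t2Map γ Γ).submatrix (Prod.map e (Prod.map e e)) (Prod.map e (Prod.map e e)) := by
  ext ⟨i, j, k⟩ ⟨l, m, n⟩
  simp only [submatrix_apply, Prod.map_apply, t2Map_apply, e.injective.eq_iff]

omit [Fintype ι] [Fintype κ] in
/-- The `T2′` block matrix is covariant under relabelling (blockwise). [cite: NakataEtAl2008, §II.B] -/
theorem t2PrimeMap_submatrix (e : κ ≃ ι) (γ : Matrix ι ι ℂ) (Γ : Matrix (ι × ι) (ι × ι) ℂ) :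
    t2PrimeMap (γ.submatrix e e) (Γ.submatrix (Prod.map e e) (Prod.map e e)) =
      (t2PrimeMap γ Γ).submatrix (Sum.map (Prod.map e (Prod.map e e)) e)
        (Sum.map (Prod.map e (Prod.map e e)) e) := by
  ext (⟨i, j, k⟩ | i) (⟨l, m, n⟩ | l)
  · simp only [t2PrimeMap, submatrix_apply, Sum.map_inl, fromBlocks_apply₁₁, Prod.map_apply,
      t2Map_apply, e.injective.eq_iff]
  · simp only [t2PrimeMap, submatrix_apply, Sum.map_inl, Sum.map_inr, fromBlocks_apply₁₂,
      of_apply, Prod.map_apply]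
  · simp only [t2PrimeMap, submatrix_apply, Sum.map_inl, Sum.map_inr, fromBlocks_apply₂₁,
      of_apply, Prod.map_apply]
  · simp only [t2PrimeMap, submatrix_apply, Sum.map_inr, fromBlocks_apply₂₂]

/-- **Gatermann–Parrilo condition (i) for the DQG programme: the feasible set is invariant under
every relabelling of the spin-orbital basis.** If `(γ, Γ)` is DQG-feasible for `N` electrons then so
is `(γ ∘ e, Γ ∘ (e × e))` for any bijection `e : κ ≃ ι` (the cones `D, Q, G ⪰ 0` go to principal
reindexings, the trace / contraction / antisymmetry rows are relabelled sums).
[cite: GatermannParrilo2004, §3 Def. 3.1 (i)] -/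
theorem IsDQGFeasible.submatrix {N : ℕ} {γ : Matrix ι ι ℂ} {Γ : Matrix (ι × ι) (ι × ι) ℂ}
    (h : IsDQGFeasible N γ Γ) (e : κ ≃ ι) :
    IsDQGFeasible N (γ.submatrix e e) (Γ.submatrix (Prod.map e e) (Prod.map e e)) where
  herm_one := h.herm_one.submatrix e
  d_psd := h.d_psd.submatrix _
  q_psd := by
    rw [qMap_submatrix]
    exact h.q_psd.submatrix _
  g_psd := by
    rw [gMap_submatrix]
    exact h.g_psd.submatrix _
  trace_one := by
    simp only [submatrix_apply]
    rw [e.sum_comp (fun i => γ i i), h.trace_one]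
  contract i k := by
    simp only [submatrix_apply, Prod.map_apply]
    rw [e.sum_comp (fun j => Γ (e i, j) (e k, j)), h.contract]
  swap_fst i j q := by
    simp only [submatrix_apply, Prod.map_apply]
    exact h.swap_fst _ _ _
  swap_snd p k l := by
    simp only [submatrix_apply, Prod.map_apply]
    exact h.swap_snd _ _ _

/-- **Condition (i) for the `PQGT1T2′` programme**: the three-index feasible set is invariant
under every relabelling as well. [cite: GatermannParrilo2004, §3 Def. 3.1 (i)] -/
theorem IsDQGT1T2PrimeFeasible.submatrix {N : ℕ} {γ : Matrix ι ι ℂ}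
    {Γ : Matrix (ι × ι) (ι × ι) ℂ} (h : IsDQGT1T2PrimeFeasible N γ Γ) (e : κ ≃ ι) :
    IsDQGT1T2PrimeFeasible N (γ.submatrix e e) (Γ.submatrix (Prod.map e e) (Prod.map e e)) where
  toIsDQGFeasible := h.toIsDQGFeasible.submatrix e
  t1_psd := by
    rw [t1Map_submatrix]
    exact h.t1_psd.submatrix _
  t2Prime_psd := by
    rw [t2PrimeMap_submatrix]
    exact h.t2Prime_psd.submatrix _

end Relabel

/-! ### Condition (i) for the `S_z`-sector programmes; condition (ii) for the cell's symmetries -/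

section Molecular

variable {Λ : Type*} [LinearOrder Λ] [Fintype Λ]

/-- **Spin-preserving orbital relabellings preserve the sector rows**: if `(γ, Γ)` is feasible for
the sector `(N_α, N_β) = (a, b)` then so is its relabelling by `Orb.mapEquiv f`, `(x, σ) ↦ (f x, σ)`,
for any orbital bijection `f : Λ ≃ Λ`. [cite: GatermannParrilo2004, §3 Def. 3.1 (i)] -/
theorem IsDQGFeasibleSector.submatrix_mapEquiv {a b : ℕ} {γ : Matrix (Orb Λ) (Orb Λ) ℂ}
    {Γ : Matrix (Orb Λ × Orb Λ) (Orb Λ × Orb Λ) ℂ} (h : IsDQGFeasibleSector a b γ Γ) (f : Λ ≃ Λ) :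
    IsDQGFeasibleSector a b (γ.submatrix (Orb.mapEquiv f) (Orb.mapEquiv f))
      (Γ.submatrix (Prod.map (Orb.mapEquiv f) (Orb.mapEquiv f))
        (Prod.map (Orb.mapEquiv f) (Orb.mapEquiv f))) where
  dqg := h.dqg.submatrix _
  spin_sel p q σ τ hστ := by
    simp only [submatrix_apply, Orb.mapEquiv_orb]
    exact h.spin_sel _ _ σ τ hστ
  trace_up := by
    simp only [submatrix_apply, Orb.mapEquiv_orb]
    rw [f.sum_comp (fun x => γ (orb x 0) (orb x 0)), h.trace_up]
  trace_down := by
    simp only [submatrix_apply, Orb.mapEquiv_orb]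
    rw [f.sum_comp (fun x => γ (orb x 1) (orb x 1)), h.trace_down]
  trace_upUp := by
    simp only [submatrix_apply, Prod.map_apply, Orb.mapEquiv_orb]
    rw [f.sum_comp (fun x => ∑ y, Γ (orb x 0, orb (f y) 0) (orb x 0, orb (f y) 0)), ← h.trace_upUp]
    exact Finset.sum_congr rfl fun x _ =>
      f.sum_comp (fun y => Γ (orb x 0, orb y 0) (orb x 0, orb y 0))
  trace_downDown := by
    simp only [submatrix_apply, Prod.map_apply, Orb.mapEquiv_orb]
    rw [f.sum_comp (fun x => ∑ y, Γ (orb x 1, orb (f y) 1) (orb x 1, orb (f y) 1)),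
      ← h.trace_downDown]
    exact Finset.sum_congr rfl fun x _ =>
      f.sum_comp (fun y => Γ (orb x 1, orb y 1) (orb x 1, orb y 1))
  trace_upDown := by
    simp only [submatrix_apply, Prod.map_apply, Orb.mapEquiv_orb]
    rw [f.sum_comp (fun x => ∑ y, Γ (orb x 0, orb (f y) 1) (orb x 0, orb (f y) 1)),
      ← h.trace_upDown]
    exact Finset.sum_congr rfl fun x _ =>
      f.sum_comp (fun y => Γ (orb x 0, orb y 1) (orb x 0, orb y 1))

/-- **The spin flip exchanges the sectors**: relabelling by `Orb.spinSwap`, `(x, σ) ↦ (x, 1 − σ)`,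
maps the `(a, b)`-sector feasible set onto the `(b, a)`-sector feasible set (so for `a = b` the
sector programme is spin-flip invariant — the symmetry behind the `M = 0` spin-flip quotient).
[cite: GatermannParrilo2004, §3 Def. 3.1 (i)] -/
theorem IsDQGFeasibleSector.submatrix_spinSwap {a b : ℕ} {γ : Matrix (Orb Λ) (Orb Λ) ℂ}
    {Γ : Matrix (Orb Λ × Orb Λ) (Orb Λ × Orb Λ) ℂ} (h : IsDQGFeasibleSector a b γ Γ) :
    IsDQGFeasibleSector b a (γ.submatrix (Orb.spinSwap : Orb Λ ≃ Orb Λ) Orb.spinSwap)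
      (Γ.submatrix (Prod.map (Orb.spinSwap : Orb Λ ≃ Orb Λ) Orb.spinSwap)
        (Prod.map (Orb.spinSwap : Orb Λ ≃ Orb Λ) Orb.spinSwap)) where
  dqg := by
    rw [Nat.add_comm]
    exact h.dqg.submatrix _
  spin_sel p q σ τ hστ := by
    simp only [submatrix_apply, Orb.spinSwap_orb]
    exact h.spin_sel _ _ _ _ fun heq => hστ ((Equiv.swap (0 : Fin 2) 1).injective heq)
  trace_up := by
    simp only [submatrix_apply, Orb.spinSwap_orb, Equiv.swap_apply_left]
    exact h.trace_down
  trace_down := by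
    simp only [submatrix_apply, Orb.spinSwap_orb, Equiv.swap_apply_right]
    exact h.trace_up
  trace_upUp := by
    simp only [submatrix_apply, Prod.map_apply, Orb.spinSwap_orb, Equiv.swap_apply_left]
    exact h.trace_downDown
  trace_downDown := by
    simp only [submatrix_apply, Prod.map_apply, Orb.spinSwap_orb, Equiv.swap_apply_right]
    exact h.trace_upUp
  trace_upDown := by
    simp only [submatrix_apply, Prod.map_apply, Orb.spinSwap_orb, Equiv.swap_apply_left,
      Equiv.swap_apply_right]
    -- the `βα` block trace equals the `αβ` block trace by the double antisymmetry of `Γ`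
    have hs : ∀ x y : Λ, Γ (orb x 1, orb y 0) (orb x 1, orb y 0) = Γ (orb y 0, orb x 1) (orb y 0, orb x 1) :=
      fun x y => by
        rw [h.dqg.swap_fst (orb y 0) (orb x 1), h.dqg.swap_snd (orb y 0, orb x 1), neg_neg]
    simp_rw [hs]
    rw [Finset.sum_comm, h.trace_upDown, mul_comm]

omit [LinearOrder Λ] in
/-- **Gatermann–Parrilo condition (ii) for an orbital symmetry of the integrals**: if a bijection
`f : Λ ≃ Λ` of the spatial orbitals preserves the integral tables (`h_{f p, f q} = h_{pq}`,
`g_{f p f q f r f s} = g_{pqrs}` — e.g. a rotation or reflection of a ring of hydrogen atoms), then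
the energy functional takes the same value on a pair and on its relabelling by `Orb.mapEquiv f`.
[cite: GatermannParrilo2004, §3 Def. 3.1 (ii)] -/
theorem rdmEnergy_submatrix_mapEquiv (h : Λ → Λ → ℂ) (g : Λ → Λ → Λ → Λ → ℂ) (hnuc : ℂ)
    (f : Λ ≃ Λ) (hh : ∀ p q, h (f p) (f q) = h p q)
    (hg : ∀ p q r s, g (f p) (f q) (f r) (f s) = g p q r s) (γ : Matrix (Orb Λ) (Orb Λ) ℂ)
    (Γ : Matrix (Orb Λ × Orb Λ) (Orb Λ × Orb Λ) ℂ) :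
    rdmEnergy h g hnuc (γ.submatrix (Orb.mapEquiv f) (Orb.mapEquiv f))
        (Γ.submatrix (Prod.map (Orb.mapEquiv f) (Orb.mapEquiv f))
          (Prod.map (Orb.mapEquiv f) (Orb.mapEquiv f))) =
      rdmEnergy h g hnuc γ Γ := by
  unfold rdmEnergy
  simp only [submatrix_apply, Prod.map_apply, Orb.mapEquiv_orb]
  congr 1
  congr 1
  · -- one-body part: substitute p ↦ f p, q ↦ f q
    rw [← f.sum_comp (fun p => ∑ q, h p q * ∑ σ : Fin 2, γ (orb p σ) (orb q σ))]
    refine Finset.sum_congr rfl fun p _ => ?_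
    rw [← f.sum_comp (fun q => h (f p) q * ∑ σ : Fin 2, γ (orb (f p) σ) (orb q σ))]
    refine Finset.sum_congr rfl fun q _ => ?_
    rw [hh]
  · congr 1
    rw [← f.sum_comp (fun p => ∑ q, ∑ r, ∑ s, g p q r s *
      ∑ σ : Fin 2, ∑ τ : Fin 2, Γ (orb p σ, orb r τ) (orb q σ, orb s τ))]
    refine Finset.sum_congr rfl fun p _ => ?_
    rw [← f.sum_comp (fun q => ∑ r, ∑ s, g (f p) q r s *
      ∑ σ : Fin 2, ∑ τ : Fin 2, Γ (orb (f p) σ, orb r τ) (orb q σ, orb s τ))]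
    refine Finset.sum_congr rfl fun q _ => ?_
    rw [← f.sum_comp (fun r => ∑ s, g (f p) (f q) r s *
      ∑ σ : Fin 2, ∑ τ : Fin 2, Γ (orb (f p) σ, orb r τ) (orb (f q) σ, orb s τ))]
    refine Finset.sum_congr rfl fun r _ => ?_
    rw [← f.sum_comp (fun s => g (f p) (f q) (f r) s *
      ∑ σ : Fin 2, ∑ τ : Fin 2, Γ (orb (f p) σ, orb (f r) τ) (orb (f q) σ, orb s τ))]
    refine Finset.sum_congr rfl fun s _ => ?_
    rw [hg]

omit [LinearOrder Λ] in
/-- **Condition (ii) for the spin flip**: the spin-free energy functional is invariant under the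
relabelling `Orb.spinSwap` (the spin sums `Σ_σ`, `Σ_{στ}` are symmetric).
[cite: GatermannParrilo2004, §3 Def. 3.1 (ii)] -/
theorem rdmEnergy_submatrix_spinSwap (h : Λ → Λ → ℂ) (g : Λ → Λ → Λ → Λ → ℂ) (hnuc : ℂ)
    (γ : Matrix (Orb Λ) (Orb Λ) ℂ) (Γ : Matrix (Orb Λ × Orb Λ) (Orb Λ × Orb Λ) ℂ) :
    rdmEnergy h g hnuc (γ.submatrix (Orb.spinSwap : Orb Λ ≃ Orb Λ) Orb.spinSwap)
        (Γ.submatrix (Prod.map (Orb.spinSwap : Orb Λ ≃ Orb Λ) Orb.spinSwap)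
          (Prod.map (Orb.spinSwap : Orb Λ ≃ Orb Λ) Orb.spinSwap)) =
      rdmEnergy h g hnuc γ Γ := by
  unfold rdmEnergy
  simp only [submatrix_apply, Prod.map_apply, Orb.spinSwap_orb, Fin.sum_univ_two,
    Equiv.swap_apply_left, Equiv.swap_apply_right]
  congr 1
  congr 1
  · exact Finset.sum_congr rfl fun p _ => Finset.sum_congr rfl fun q _ => by ring
  · congr 1
    exact Finset.sum_congr rfl fun p _ => Finset.sum_congr rfl fun q _ =>
      Finset.sum_congr rfl fun r _ => Finset.sum_congr rfl fun s _ => by ring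

end Molecular

/-! ### Convexity and the group average (Reynolds operator) -/

section Average

variable {ι : Type*} [LinearOrder ι] [Fintype ι]
variable {G : Type*} [Group G] [Fintype G]

omit [Fintype ι] in
/-- The `Q`-map is AFFINE: on an average with total weight one it is the average of the `Q`-maps.
[cite: Mazziotti2007RDMChapter, §II.B eq. (14)] -/
theorem qMap_sum_smul {α : Type*} (s : Finset α) (w : α → ℂ) (hw : ∑ a ∈ s, w a = 1)
    (γ : α → Matrix ι ι ℂ) (Γ : α → Matrix (ι × ι) (ι × ι) ℂ) :
    qMap (∑ a ∈ s, w a • γ a) (∑ a ∈ s, w a • Γ a) = ∑ a ∈ s, w a • qMap (γ a) (Γ a) := by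
  ext ⟨i, j⟩ ⟨k, l⟩
  have P : ∀ a, w a * qMap (γ a) (Γ a) (i, j) (k, l) =
      w a * (((if i = k then (1 : ℂ) else 0) * (if j = l then (1 : ℂ) else 0) -
          (if i = l then (1 : ℂ) else 0) * (if j = k then (1 : ℂ) else 0))) -
        (if j = l then (1 : ℂ) else 0) * (w a * γ a k i) +
        (if j = k then (1 : ℂ) else 0) * (w a * γ a l i) +
        (if i = l then (1 : ℂ) else 0) * (w a * γ a k j) -
        (if i = k then (1 : ℂ) else 0) * (w a * γ a l j) +
        w a * Γ a (k, l) (i, j) := fun a => by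
    rw [qMap_apply]
    ring
  simp only [Matrix.sum_apply, Matrix.smul_apply, smul_eq_mul, P, Finset.sum_add_distrib,
    Finset.sum_sub_distrib, ← Finset.mul_sum, ← Finset.sum_mul, hw, one_mul]
  rw [qMap_apply]
  simp only [Matrix.sum_apply, Matrix.smul_apply, smul_eq_mul]

omit [Fintype ι] in
/-- The `G`-map is LINEAR: it commutes with weighted sums. [cite: Mazziotti2007RDMChapter, §II.B eq. (15)] -/
theorem gMap_sum_smul {α : Type*} (s : Finset α) (w : α → ℂ) (γ : α → Matrix ι ι ℂ)
    (Γ : α → Matrix (ι × ι) (ι × ι) ℂ) :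
    gMap (∑ a ∈ s, w a • γ a) (∑ a ∈ s, w a • Γ a) = ∑ a ∈ s, w a • gMap (γ a) (Γ a) := by
  ext ⟨i, j⟩ ⟨k, l⟩
  have P : ∀ a, w a * gMap (γ a) (Γ a) (i, j) (k, l) =
      (if j = l then w a * γ a i k else 0) - w a * Γ a (i, l) (k, j) := fun a => by
    rw [gMap_apply]
    split_ifs <;> ring
  simp only [Matrix.sum_apply, Matrix.smul_apply, smul_eq_mul, P, Finset.sum_sub_distrib]
  rw [gMap_apply]
  simp only [Matrix.sum_apply, Matrix.smul_apply, smul_eq_mul]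
  split_ifs <;> simp

/-- **The DQG-feasible set is convex**: a weighted average (non-negative weights summing to one)
of feasible pairs is feasible — "since the positive matrices form a convex cone each convex
combination such as the group average defines another positive definite matrix", and the linear
rows are affine. [cite: GatermannParrilo2004, §3 proof of Thm. 3.3] -/
theorem IsDQGFeasible.sum_smul {N : ℕ} {α : Type*} (s : Finset α) (w : α → ℝ)
    (hw0 : ∀ a ∈ s, 0 ≤ w a) (hw1 : ∑ a ∈ s, w a = 1) {γ : α → Matrix ι ι ℂ}
    {Γ : α → Matrix (ι × ι) (ι × ι) ℂ} (h : ∀ a ∈ s, IsDQGFeasible N (γ a) (Γ a)) :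
    IsDQGFeasible N (∑ a ∈ s, ((w a : ℝ) : ℂ) • γ a) (∑ a ∈ s, ((w a : ℝ) : ℂ) • Γ a) := by
  have hw1' : ∑ a ∈ s, ((w a : ℝ) : ℂ) = 1 := by rw [← Complex.ofReal_sum, hw1, Complex.ofReal_one]
  have hwc : ∀ a ∈ s, (0 : ℂ) ≤ ((w a : ℝ) : ℂ) := fun a ha => Complex.zero_le_real.mpr (hw0 a ha)
  refine
    { herm_one := ?_, d_psd := ?_, q_psd := ?_, g_psd := ?_, trace_one := ?_, contract := ?_,
      swap_fst := ?_, swap_snd := ?_ }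
  · exact (posSemidef_sum _ fun a ha => (h a ha).one_posSemidef.smul (hwc a ha)).1
  · exact posSemidef_sum _ fun a ha => (h a ha).d_psd.smul (hwc a ha)
  · rw [qMap_sum_smul s _ hw1']
    exact posSemidef_sum _ fun a ha => (h a ha).q_psd.smul (hwc a ha)
  · rw [gMap_sum_smul]
    exact posSemidef_sum _ fun a ha => (h a ha).g_psd.smul (hwc a ha)
  · simp only [Matrix.sum_apply, Matrix.smul_apply, smul_eq_mul]
    rw [Finset.sum_comm]
    calc ∑ a ∈ s, ∑ i, ((w a : ℝ) : ℂ) * γ a i i = ∑ a ∈ s, ((w a : ℝ) : ℂ) * (N : ℂ) :=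
          Finset.sum_congr rfl fun a ha => by rw [← Finset.mul_sum, (h a ha).trace_one]
      _ = (N : ℂ) := by rw [← Finset.sum_mul, hw1', one_mul]
  · intro i k
    simp only [Matrix.sum_apply, Matrix.smul_apply, smul_eq_mul]
    rw [Finset.sum_comm, Finset.mul_sum]
    refine Finset.sum_congr rfl fun a ha => ?_
    rw [← Finset.mul_sum, (h a ha).contract i k]
    ring
  · intro i j q
    simp only [Matrix.sum_apply, Matrix.smul_apply, smul_eq_mul, ← Finset.sum_neg_distrib]
    exact Finset.sum_congr rfl fun a ha => by rw [(h a ha).swap_fst i j q, mul_neg]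
  · intro p k l
    simp only [Matrix.sum_apply, Matrix.smul_apply, smul_eq_mul, ← Finset.sum_neg_distrib]
    exact Finset.sum_congr rfl fun a ha => by rw [(h a ha).swap_snd p k l, mul_neg]

/-- The sector rows are affine too: **the `S_z`-sector feasible set is convex**.
[cite: GatermannParrilo2004, §3 proof of Thm. 3.3] -/
theorem IsDQGFeasibleSector.sum_smul {Λ : Type*} [LinearOrder Λ] [Fintype Λ] {a b : ℕ} {α : Type*}
    (s : Finset α) (w : α → ℝ) (hw0 : ∀ x ∈ s, 0 ≤ w x) (hw1 : ∑ x ∈ s, w x = 1)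
    {γ : α → Matrix (Orb Λ) (Orb Λ) ℂ} {Γ : α → Matrix (Orb Λ × Orb Λ) (Orb Λ × Orb Λ) ℂ}
    (h : ∀ x ∈ s, IsDQGFeasibleSector a b (γ x) (Γ x)) :
    IsDQGFeasibleSector a b (∑ x ∈ s, ((w x : ℝ) : ℂ) • γ x) (∑ x ∈ s, ((w x : ℝ) : ℂ) • Γ x) := by
  have hw1' : ∑ x ∈ s, ((w x : ℝ) : ℂ) = 1 := by rw [← Complex.ofReal_sum, hw1, Complex.ofReal_one]
  -- a weighted sum of rows with a common right-hand side
  have row : ∀ (f : α → ℂ) (c : ℂ), (∀ x ∈ s, f x = c) → ∑ x ∈ s, ((w x : ℝ) : ℂ) * f x = c :=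
    fun f c hf => by
      rw [Finset.sum_congr rfl fun x hx => by rw [hf x hx], ← Finset.sum_mul, hw1', one_mul]
  -- reorder: the weight sum outermost, the weight factored out
  have c2 : ∀ f : Λ → α → ℂ, ∑ y, ∑ x ∈ s, ((w x : ℝ) : ℂ) * f y x =
      ∑ x ∈ s, ((w x : ℝ) : ℂ) * ∑ y, f y x := fun f => by
    rw [Finset.sum_comm]
    exact Finset.sum_congr rfl fun x _ => (Finset.mul_sum _ _ _).symm
  have c3 : ∀ f : Λ → Λ → α → ℂ, ∑ y, ∑ y', ∑ x ∈ s, ((w x : ℝ) : ℂ) * f y y' x =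
      ∑ x ∈ s, ((w x : ℝ) : ℂ) * ∑ y, ∑ y', f y y' x := fun f => by
    calc ∑ y, ∑ y', ∑ x ∈ s, ((w x : ℝ) : ℂ) * f y y' x
        = ∑ y, ∑ x ∈ s, ∑ y', ((w x : ℝ) : ℂ) * f y y' x :=
          Finset.sum_congr rfl fun y _ => Finset.sum_comm
      _ = ∑ x ∈ s, ∑ y, ∑ y', ((w x : ℝ) : ℂ) * f y y' x := Finset.sum_comm
      _ = ∑ x ∈ s, ((w x : ℝ) : ℂ) * ∑ y, ∑ y', f y y' x :=
          Finset.sum_congr rfl fun x _ => by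
            rw [Finset.mul_sum]
            exact Finset.sum_congr rfl fun y _ => (Finset.mul_sum _ _ _).symm
  refine
    { dqg := IsDQGFeasible.sum_smul s w hw0 hw1 fun x hx => (h x hx).dqg
      spin_sel := ?_, trace_up := ?_, trace_down := ?_, trace_upUp := ?_, trace_downDown := ?_,
      trace_upDown := ?_ }
  · intro p q σ' τ hστ
    simp only [Matrix.sum_apply, Matrix.smul_apply, smul_eq_mul]
    exact Finset.sum_eq_zero fun x hx => by rw [(h x hx).spin_sel p q σ' τ hστ, mul_zero]
  all_goals simp only [Matrix.sum_apply, Matrix.smul_apply, smul_eq_mul]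
  · rw [c2 fun y x => γ x (orb y 0) (orb y 0)]
    exact row _ _ fun x hx => (h x hx).trace_up
  · rw [c2 fun y x => γ x (orb y 1) (orb y 1)]
    exact row _ _ fun x hx => (h x hx).trace_down
  · rw [c3 fun y y' x => Γ x (orb y 0, orb y' 0) (orb y 0, orb y' 0)]
    exact row _ _ fun x hx => (h x hx).trace_upUp
  · rw [c3 fun y y' x => Γ x (orb y 1, orb y' 1) (orb y 1, orb y' 1)]
    exact row _ _ fun x hx => (h x hx).trace_downDown
  · rw [c3 fun y y' x => Γ x (orb y 0, orb y' 1) (orb y 0, orb y' 1)]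
    exact row _ _ fun x hx => (h x hx).trace_upDown

end Average

/-! ### The energy functional is affine -/

section Affine

variable {Λ : Type*} [LinearOrder Λ] [Fintype Λ]

omit [LinearOrder Λ] in
/-- The energy functional is AFFINE: additive up to the constant `h_nuc`.
[cite: Mazziotti2007RDMChapter, §II.A eqs. (4)-(7)] -/
theorem rdmEnergy_add (h : Λ → Λ → ℂ) (g : Λ → Λ → Λ → Λ → ℂ) (hnuc : ℂ)
    (γ₁ γ₂ : Matrix (Orb Λ) (Orb Λ) ℂ) (Γ₁ Γ₂ : Matrix (Orb Λ × Orb Λ) (Orb Λ × Orb Λ) ℂ) :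
    rdmEnergy h g hnuc (γ₁ + γ₂) (Γ₁ + Γ₂) = rdmEnergy h g hnuc γ₁ Γ₁ + rdmEnergy h g hnuc γ₂ Γ₂ - hnuc := by
  unfold rdmEnergy
  simp only [Matrix.add_apply, Finset.sum_add_distrib, mul_add]
  ring

omit [LinearOrder Λ] in
/-- The energy functional is AFFINE: homogeneous up to the constant `h_nuc`.
[cite: Mazziotti2007RDMChapter, §II.A eqs. (4)-(7)] -/
theorem rdmEnergy_smul (h : Λ → Λ → ℂ) (g : Λ → Λ → Λ → Λ → ℂ) (hnuc : ℂ) (c : ℂ)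
    (γ : Matrix (Orb Λ) (Orb Λ) ℂ) (Γ : Matrix (Orb Λ × Orb Λ) (Orb Λ × Orb Λ) ℂ) :
    rdmEnergy h g hnuc (c • γ) (c • Γ) = c * rdmEnergy h g hnuc γ Γ + (1 - c) * hnuc := by
  unfold rdmEnergy
  have hc : ∀ x y : ℂ, x * (c * y) = c * (x * y) := fun x y => mul_left_comm x c y
  simp only [Matrix.smul_apply, smul_eq_mul, ← Finset.mul_sum, hc]
  ring

omit [LinearOrder Λ] in
/-- The energy functional on a weighted sum: `E(Σ w•γ, Σ w•Γ) = Σ w E(γ, Γ) + (1 − Σ w) h_nuc`.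
[cite: Mazziotti2007RDMChapter, §II.A eqs. (4)-(7)] -/
theorem rdmEnergy_sum_smul (h : Λ → Λ → ℂ) (g : Λ → Λ → Λ → Λ → ℂ) (hnuc : ℂ) {α : Type*}
    (s : Finset α) (w : α → ℂ) (γ : α → Matrix (Orb Λ) (Orb Λ) ℂ)
    (Γ : α → Matrix (Orb Λ × Orb Λ) (Orb Λ × Orb Λ) ℂ) :
    rdmEnergy h g hnuc (∑ x ∈ s, w x • γ x) (∑ x ∈ s, w x • Γ x) =
      ∑ x ∈ s, w x * rdmEnergy h g hnuc (γ x) (Γ x) + (1 - ∑ x ∈ s, w x) * hnuc := by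
  classical
  induction s using Finset.induction_on with
  | empty =>
    simp only [Finset.sum_empty, sub_zero, one_mul, zero_add]
    unfold rdmEnergy
    simp
  | insert b s hb ih =>
    rw [Finset.sum_insert hb, Finset.sum_insert hb, Finset.sum_insert hb, Finset.sum_insert hb,
      rdmEnergy_add, rdmEnergy_smul, ih]
    ring

end Affine

/-! ### The three-index programme: affinity of `T1`, `T2`, `T2′` and convexity -/

section ThreeIndexAffine

variable {ι : Type*} [LinearOrder ι] [Fintype ι]

omit [Fintype ι] in
/-- The `T1` functional is AFFINE: on an average with total weight one it is the average of the `T1`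
functionals. [cite: NakataEtAl2008, §II.A] -/
theorem t1Map_sum_smul {α : Type*} (s : Finset α) (w : α → ℂ) (hw : ∑ a ∈ s, w a = 1)
    (γ : α → Matrix ι ι ℂ) (Γ : α → Matrix (ι × ι) (ι × ι) ℂ) :
    t1Map (∑ a ∈ s, w a • γ a) (∑ a ∈ s, w a • Γ a) = ∑ a ∈ s, w a • t1Map (γ a) (Γ a) := by
  ext ⟨i, j, k⟩ ⟨l, m, n⟩
  have P : ∀ a, w a * t1Map (γ a) (Γ a) (i, j, k) (l, m, n) =
      w a * ((if l = i then (1 : ℂ) else 0) * (if m = j then (1 : ℂ) else 0) * (if n = k then (1 : ℂ) else 0)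
      - (if l = i then (1 : ℂ) else 0) * (if m = k then (1 : ℂ) else 0) * (if n = j then (1 : ℂ) else 0)
      - (if l = j then (1 : ℂ) else 0) * (if m = i then (1 : ℂ) else 0) * (if n = k then (1 : ℂ) else 0)
      + (if l = j then (1 : ℂ) else 0) * (if m = k then (1 : ℂ) else 0) * (if n = i then (1 : ℂ) else 0)
      + (if l = k then (1 : ℂ) else 0) * (if m = i then (1 : ℂ) else 0) * (if n = j then (1 : ℂ) else 0)
      - (if l = k then (1 : ℂ) else 0) * (if m = j then (1 : ℂ) else 0) * (if n = i then (1 : ℂ) else 0))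
      + (if l = i then (1 : ℂ) else 0) * (w a * Γ a (j, k) (m, n))
      - (if l = j then (1 : ℂ) else 0) * (w a * Γ a (i, k) (m, n))
      + (if l = k then (1 : ℂ) else 0) * (w a * Γ a (i, j) (m, n))
      - (if m = i then (1 : ℂ) else 0) * (w a * Γ a (j, k) (l, n))
      + (if m = j then (1 : ℂ) else 0) * (w a * Γ a (i, k) (l, n))
      - (if m = k then (1 : ℂ) else 0) * (w a * Γ a (i, j) (l, n))
      + (if n = i then (1 : ℂ) else 0) * (w a * Γ a (j, k) (l, m))
      - (if n = j then (1 : ℂ) else 0) * (w a * Γ a (i, k) (l, m))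
      + (if n = k then (1 : ℂ) else 0) * (w a * Γ a (i, j) (l, m))
      - (if l = i then (1 : ℂ) else 0) * (if m = j then (1 : ℂ) else 0) * (w a * γ a k n)
      + (if l = i then (1 : ℂ) else 0) * (if m = k then (1 : ℂ) else 0) * (w a * γ a j n)
      + (if l = i then (1 : ℂ) else 0) * (if n = j then (1 : ℂ) else 0) * (w a * γ a k m)
      - (if l = i then (1 : ℂ) else 0) * (if n = k then (1 : ℂ) else 0) * (w a * γ a j m)
      + (if l = j then (1 : ℂ) else 0) * (if m = i then (1 : ℂ) else 0) * (w a * γ a k n)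
      - (if l = j then (1 : ℂ) else 0) * (if m = k then (1 : ℂ) else 0) * (w a * γ a i n)
      - (if l = j then (1 : ℂ) else 0) * (if n = i then (1 : ℂ) else 0) * (w a * γ a k m)
      + (if l = j then (1 : ℂ) else 0) * (if n = k then (1 : ℂ) else 0) * (w a * γ a i m)
      - (if l = k then (1 : ℂ) else 0) * (if m = i then (1 : ℂ) else 0) * (w a * γ a j n)
      + (if l = k then (1 : ℂ) else 0) * (if m = j then (1 : ℂ) else 0) * (w a * γ a i n)
      + (if l = k then (1 : ℂ) else 0) * (if n = i then (1 : ℂ) else 0) * (w a * γ a j m)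
      - (if l = k then (1 : ℂ) else 0) * (if n = j then (1 : ℂ) else 0) * (w a * γ a i m)
      - (if m = i then (1 : ℂ) else 0) * (if n = j then (1 : ℂ) else 0) * (w a * γ a k l)
      + (if m = i then (1 : ℂ) else 0) * (if n = k then (1 : ℂ) else 0) * (w a * γ a j l)
      + (if m = j then (1 : ℂ) else 0) * (if n = i then (1 : ℂ) else 0) * (w a * γ a k l)
      - (if m = j then (1 : ℂ) else 0) * (if n = k then (1 : ℂ) else 0) * (w a * γ a i l)
      - (if m = k then (1 : ℂ) else 0) * (if n = i then (1 : ℂ) else 0) * (w a * γ a j l)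
      + (if m = k then (1 : ℂ) else 0) * (if n = j then (1 : ℂ) else 0) * (w a * γ a i l) := fun a => by
    rw [t1Map_apply]
    ring
  simp only [Matrix.sum_apply, Matrix.smul_apply, smul_eq_mul, P, Finset.sum_add_distrib,
    Finset.sum_sub_distrib, ← Finset.mul_sum, ← Finset.sum_mul, hw, one_mul]
  rw [t1Map_apply]
  simp only [Matrix.sum_apply, Matrix.smul_apply, smul_eq_mul]
  ring

omit [Fintype ι] in
/-- The `T2` functional is LINEAR. [cite: NakataEtAl2008, §II.A] -/
theorem t2Map_sum_smul {α : Type*} (s : Finset α) (w : α → ℂ) (γ : α → Matrix ι ι ℂ)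
    (Γ : α → Matrix (ι × ι) (ι × ι) ℂ) :
    t2Map (∑ a ∈ s, w a • γ a) (∑ a ∈ s, w a • Γ a) = ∑ a ∈ s, w a • t2Map (γ a) (Γ a) := by
  ext ⟨i, j, k⟩ ⟨l, m, n⟩
  have P : ∀ a, w a * t2Map (γ a) (Γ a) (i, j, k) (l, m, n) =
      (if k = n then (1 : ℂ) else 0) * (w a * Γ a (i, j) (l, m))
      - (if l = i then (1 : ℂ) else 0) * (w a * Γ a (n, j) (k, m))
      + (if l = j then (1 : ℂ) else 0) * (w a * Γ a (n, i) (k, m))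
      + (if m = i then (1 : ℂ) else 0) * (w a * Γ a (n, j) (k, l))
      - (if m = j then (1 : ℂ) else 0) * (w a * Γ a (n, i) (k, l))
      + (if l = i then (1 : ℂ) else 0) * (if m = j then (1 : ℂ) else 0) * (w a * γ a n k)
      - (if l = j then (1 : ℂ) else 0) * (if m = i then (1 : ℂ) else 0) * (w a * γ a n k) := fun a => by
    rw [t2Map_apply]
    ring
  simp only [Matrix.sum_apply, Matrix.smul_apply, smul_eq_mul, P, Finset.sum_add_distrib,
    Finset.sum_sub_distrib, ← Finset.mul_sum]
  rw [t2Map_apply]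
  simp only [Matrix.sum_apply, Matrix.smul_apply, smul_eq_mul]

omit [Fintype ι] in
/-- The `T2′` block matrix is LINEAR (blockwise). [cite: NakataEtAl2008, §II.B] -/
theorem t2PrimeMap_sum_smul {α : Type*} (s : Finset α) (w : α → ℂ) (γ : α → Matrix ι ι ℂ)
    (Γ : α → Matrix (ι × ι) (ι × ι) ℂ) :
    t2PrimeMap (∑ a ∈ s, w a • γ a) (∑ a ∈ s, w a • Γ a) = ∑ a ∈ s, w a • t2PrimeMap (γ a) (Γ a) := by
  ext (I | i) (J | l)
  · rw [Matrix.sum_apply]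
    simp only [t2PrimeMap, fromBlocks_apply₁₁, Matrix.smul_apply, smul_eq_mul]
    rw [t2Map_sum_smul, Matrix.sum_apply]
    simp only [Matrix.smul_apply, smul_eq_mul]
  · simp only [t2PrimeMap, Matrix.sum_apply, fromBlocks_apply₁₂, of_apply, Matrix.smul_apply,
      smul_eq_mul]
  · simp only [t2PrimeMap, Matrix.sum_apply, fromBlocks_apply₂₁, of_apply, Matrix.smul_apply,
      smul_eq_mul]
  · simp only [t2PrimeMap, Matrix.sum_apply, fromBlocks_apply₂₂, Matrix.smul_apply, smul_eq_mul]

/-- **The `PQGT1T2′`-feasible set is convex.** [cite: GatermannParrilo2004, §3 proof of Thm. 3.3] -/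
theorem IsDQGT1T2PrimeFeasible.sum_smul {N : ℕ} {α : Type*} (s : Finset α) (w : α → ℝ)
    (hw0 : ∀ a ∈ s, 0 ≤ w a) (hw1 : ∑ a ∈ s, w a = 1) {γ : α → Matrix ι ι ℂ}
    {Γ : α → Matrix (ι × ι) (ι × ι) ℂ} (h : ∀ a ∈ s, IsDQGT1T2PrimeFeasible N (γ a) (Γ a)) :
    IsDQGT1T2PrimeFeasible N (∑ a ∈ s, ((w a : ℝ) : ℂ) • γ a) (∑ a ∈ s, ((w a : ℝ) : ℂ) • Γ a) := by
  have hw1' : ∑ a ∈ s, ((w a : ℝ) : ℂ) = 1 := by rw [← Complex.ofReal_sum, hw1, Complex.ofReal_one]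
  have hwc : ∀ a ∈ s, (0 : ℂ) ≤ ((w a : ℝ) : ℂ) := fun a ha => Complex.zero_le_real.mpr (hw0 a ha)
  refine
    { toIsDQGFeasible := IsDQGFeasible.sum_smul s w hw0 hw1 fun a ha => (h a ha).toIsDQGFeasible
      t1_psd := ?_, t2Prime_psd := ?_ }
  · rw [t1Map_sum_smul s _ hw1']
    exact posSemidef_sum _ fun a ha => (h a ha).t1_psd.smul (hwc a ha)
  · rw [t2PrimeMap_sum_smul]
    exact posSemidef_sum _ fun a ha => (h a ha).t2Prime_psd.smul (hwc a ha)

end ThreeIndexAffine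

/-! ### The group average and Theorem 3.3 for `E_PQG` -/

section Reynolds

variable {Λ : Type*} [LinearOrder Λ] [Fintype Λ]
variable {G : Type*} [Group G] [Fintype G]

/-- The uniform weights `1/|G|` sum to one. [folklore] -/
private theorem sum_card_inv_eq_one : ∑ _g : G, ((Fintype.card G : ℝ)⁻¹ : ℝ) = 1 := by
  rw [Finset.sum_const, Finset.card_univ, nsmul_eq_mul,
    mul_inv_cancel₀ (Nat.cast_ne_zero.mpr (Fintype.card_pos_iff.mpr ⟨1⟩).ne')]

/-- **The group average (Reynolds operator) of a feasible pair is feasible.** For a finite group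
`G` acting on the spin-orbital labels through `σ : G →* Equiv.Perm (Orb Λ)`, the average
`(1/|G|) Σ_g (γ ∘ σ(g), Γ ∘ σ(g))` of a DQG-feasible pair is DQG-feasible (condition (i) for each
`σ(g)` plus convexity). [cite: GatermannParrilo2004, §3 proof of Thm. 3.3] -/
theorem IsDQGFeasible.average (σ : G →* Equiv.Perm (Orb Λ)) {N : ℕ} {γ : Matrix (Orb Λ) (Orb Λ) ℂ}
    {Γ : Matrix (Orb Λ × Orb Λ) (Orb Λ × Orb Λ) ℂ} (h : IsDQGFeasible N γ Γ) :
    IsDQGFeasible N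
      (∑ g : G, (((Fintype.card G : ℝ)⁻¹ : ℝ) : ℂ) • γ.submatrix (σ g) (σ g))
      (∑ g : G, (((Fintype.card G : ℝ)⁻¹ : ℝ) : ℂ) •
        Γ.submatrix (Prod.map (σ g) (σ g)) (Prod.map (σ g) (σ g))) :=
  IsDQGFeasible.sum_smul Finset.univ (fun _ => (Fintype.card G : ℝ)⁻¹)
    (fun _ _ => inv_nonneg.mpr (Nat.cast_nonneg _)) sum_card_inv_eq_one fun g _ => h.submatrix (σ g)

omit [LinearOrder Λ] [Fintype Λ] in
/-- The averaged 1-matrix is `σ`-INVARIANT ("by construction `X_σ ∈ 𝓕`"): relabelling by `σ(g₀)`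
permutes the summands. [cite: GatermannParrilo2004, §3 proof of Thm. 3.3] -/
theorem average_one_submatrix (σ : G →* Equiv.Perm (Orb Λ)) (c : ℂ) (γ : Matrix (Orb Λ) (Orb Λ) ℂ)
    (g₀ : G) :
    (∑ g : G, c • γ.submatrix (σ g) (σ g)).submatrix (σ g₀) (σ g₀) =
      ∑ g : G, c • γ.submatrix (σ g) (σ g) := by
  ext i j
  simp only [submatrix_apply, Matrix.sum_apply, Matrix.smul_apply, smul_eq_mul]
  rw [← Equiv.sum_comp (Equiv.mulRight g₀) (fun g => c * γ ((σ g) i) ((σ g) j))]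
  refine Finset.sum_congr rfl fun g _ => ?_
  simp only [Equiv.coe_mulRight, map_mul, Equiv.Perm.coe_mul, Function.comp_apply]

omit [LinearOrder Λ] [Fintype Λ] in
/-- The averaged 2-matrix is `σ`-invariant. [cite: GatermannParrilo2004, §3 proof of Thm. 3.3] -/
theorem average_two_submatrix (σ : G →* Equiv.Perm (Orb Λ)) (c : ℂ)
    (Γ : Matrix (Orb Λ × Orb Λ) (Orb Λ × Orb Λ) ℂ) (g₀ : G) :
    (∑ g : G, c • Γ.submatrix (Prod.map (σ g) (σ g)) (Prod.map (σ g) (σ g))).submatrix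
        (Prod.map (σ g₀) (σ g₀)) (Prod.map (σ g₀) (σ g₀)) =
      ∑ g : G, c • Γ.submatrix (Prod.map (σ g) (σ g)) (Prod.map (σ g) (σ g)) := by
  ext ⟨i, j⟩ ⟨k, l⟩
  simp only [submatrix_apply, Matrix.sum_apply, Matrix.smul_apply, smul_eq_mul, Prod.map_apply]
  rw [← Equiv.sum_comp (Equiv.mulRight g₀)
    (fun g => c * Γ ((σ g) i, (σ g) j) ((σ g) k, (σ g) l))]
  refine Finset.sum_congr rfl fun g _ => ?_
  simp only [Equiv.coe_mulRight, map_mul, Equiv.Perm.coe_mul, Function.comp_apply]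

omit [LinearOrder Λ] in
/-- **The average has the same energy** when the functional is `σ`-invariant (condition (ii)):
`E(X_σ) = (1/|G|) Σ_g E(σ(g) X) = E(X)` by affinity of `E`. [cite: GatermannParrilo2004, §3 proof of Thm. 3.3] -/
theorem rdmEnergy_average (h : Λ → Λ → ℂ) (g₂ : Λ → Λ → Λ → Λ → ℂ) (hnuc : ℂ)
    (σ : G →* Equiv.Perm (Orb Λ))
    (hE : ∀ (g : G) (γ : Matrix (Orb Λ) (Orb Λ) ℂ) (Γ : Matrix (Orb Λ × Orb Λ) (Orb Λ × Orb Λ) ℂ),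
      rdmEnergy h g₂ hnuc (γ.submatrix (σ g) (σ g))
          (Γ.submatrix (Prod.map (σ g) (σ g)) (Prod.map (σ g) (σ g))) = rdmEnergy h g₂ hnuc γ Γ)
    (γ : Matrix (Orb Λ) (Orb Λ) ℂ) (Γ : Matrix (Orb Λ × Orb Λ) (Orb Λ × Orb Λ) ℂ) :
    rdmEnergy h g₂ hnuc
        (∑ g : G, (((Fintype.card G : ℝ)⁻¹ : ℝ) : ℂ) • γ.submatrix (σ g) (σ g))
        (∑ g : G, (((Fintype.card G : ℝ)⁻¹ : ℝ) : ℂ) •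
          Γ.submatrix (Prod.map (σ g) (σ g)) (Prod.map (σ g) (σ g))) =
      rdmEnergy h g₂ hnuc γ Γ := by
  have hw : ∑ _g : G, (((Fintype.card G : ℝ)⁻¹ : ℝ) : ℂ) = 1 := by
    rw [← Complex.ofReal_sum, sum_card_inv_eq_one, Complex.ofReal_one]
  rw [rdmEnergy_sum_smul]
  simp_rw [hE]
  rw [← Finset.sum_mul, hw, one_mul, sub_self, zero_mul, add_zero]

/-- **Theorem 3.3 (Gatermann–Parrilo) for the variational 2-RDM programme: the fixed-point
restricted programme has the same value.** If the energy functional is invariant under the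
relabellings `σ(g)` of a finite group (condition (ii); condition (i) holds for every relabelling),
then a number `c` lies below `E(γ, Γ)` on the whole DQG-feasible set — i.e. `c ≤ E_PQG` — iff it
lies below `E` on the `σ`-INVARIANT feasible pairs only (`N ≤ 2|Λ|`).
[cite: GatermannParrilo2004, §3 Thm. 3.3] -/
theorem le_pqgEnergy_iff_invariant (h : Λ → Λ → ℂ) (g₂ : Λ → Λ → Λ → Λ → ℂ) (hnuc : ℂ) {N : ℕ}
    (hN : N ≤ Fintype.card (Orb Λ)) (σ : G →* Equiv.Perm (Orb Λ))
    (hE : ∀ (g : G) (γ : Matrix (Orb Λ) (Orb Λ) ℂ) (Γ : Matrix (Orb Λ × Orb Λ) (Orb Λ × Orb Λ) ℂ),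
      rdmEnergy h g₂ hnuc (γ.submatrix (σ g) (σ g))
          (Γ.submatrix (Prod.map (σ g) (σ g)) (Prod.map (σ g) (σ g))) = rdmEnergy h g₂ hnuc γ Γ)
    {c : ℝ} :
    c ≤ pqgEnergy h g₂ hnuc N ↔
      ∀ γ Γ, IsDQGFeasible N γ Γ →
        (∀ g : G, γ.submatrix (σ g) (σ g) = γ ∧
            Γ.submatrix (Prod.map (σ g) (σ g)) (Prod.map (σ g) (σ g)) = Γ) →
          c ≤ (rdmEnergy h g₂ hnuc γ Γ).re := by
  rw [le_pqgEnergy_iff h g₂ hnuc hN]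
  constructor
  · intro hc γ Γ hf _
    exact hc γ Γ hf
  · intro hc γ Γ hf
    rw [← rdmEnergy_average h g₂ hnuc σ hE γ Γ]
    exact hc _ _ (hf.average σ) fun g =>
      ⟨average_one_submatrix σ _ γ g, average_two_submatrix σ _ Γ g⟩

/-- **The minimum `E_PQG` is attained at a `σ`-invariant feasible pair** ("when convexity is
present … the search for solutions can always be restricted a priori to the fixed-point
subspace"): average a minimiser. [cite: GatermannParrilo2004, §3 Thm. 3.3] -/
theorem exists_invariant_isDQGFeasible_rdmEnergy_eq_pqgEnergy (h : Λ → Λ → ℂ)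
    (g₂ : Λ → Λ → Λ → Λ → ℂ) (hnuc : ℂ) {N : ℕ} (hN : N ≤ Fintype.card (Orb Λ))
    (σ : G →* Equiv.Perm (Orb Λ))
    (hE : ∀ (g : G) (γ : Matrix (Orb Λ) (Orb Λ) ℂ) (Γ : Matrix (Orb Λ × Orb Λ) (Orb Λ × Orb Λ) ℂ),
      rdmEnergy h g₂ hnuc (γ.submatrix (σ g) (σ g))
          (Γ.submatrix (Prod.map (σ g) (σ g)) (Prod.map (σ g) (σ g))) = rdmEnergy h g₂ hnuc γ Γ) :
    ∃ γ Γ, IsDQGFeasible N γ Γ ∧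
      (∀ g : G, γ.submatrix (σ g) (σ g) = γ ∧
          Γ.submatrix (Prod.map (σ g) (σ g)) (Prod.map (σ g) (σ g)) = Γ) ∧
        (rdmEnergy h g₂ hnuc γ Γ).re = pqgEnergy h g₂ hnuc N := by
  obtain ⟨γ, Γ, hf, hE0⟩ := exists_isDQGFeasible_rdmEnergy_eq_pqgEnergy h g₂ hnuc hN
  refine ⟨_, _, hf.average σ, fun g => ⟨average_one_submatrix σ _ γ g, average_two_submatrix σ _ Γ g⟩, ?_⟩
  rw [rdmEnergy_average h g₂ hnuc σ hE γ Γ, hE0]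

omit [LinearOrder Λ] [Fintype G] in
/-- **Condition (ii) from an orbital symmetry group of the integrals.** If `G` acts on the spatial
orbitals by `ρ : G →* Equiv.Perm Λ` preserving the integral tables, then the energy functional is
invariant under the lifted relabellings `Orb.mapPerm ∘ ρ` of the spin orbitals — the hypothesis
`hE` of the two theorems above (e.g. the cyclic or dihedral group of a hydrogen ring).
[cite: GatermannParrilo2004, §3 Def. 3.1 (ii)] -/
theorem rdmEnergy_submatrix_mapPerm (h : Λ → Λ → ℂ) (g₂ : Λ → Λ → Λ → Λ → ℂ) (hnuc : ℂ)
    (ρ : G →* Equiv.Perm Λ) (hh : ∀ (x : G) p q, h (ρ x p) (ρ x q) = h p q)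
    (hg : ∀ (x : G) p q r s, g₂ (ρ x p) (ρ x q) (ρ x r) (ρ x s) = g₂ p q r s) (x : G)
    (γ : Matrix (Orb Λ) (Orb Λ) ℂ) (Γ : Matrix (Orb Λ × Orb Λ) (Orb Λ × Orb Λ) ℂ) :
    rdmEnergy h g₂ hnuc (γ.submatrix ((Orb.mapPerm.comp ρ) x) ((Orb.mapPerm.comp ρ) x))
        (Γ.submatrix (Prod.map ((Orb.mapPerm.comp ρ) x) ((Orb.mapPerm.comp ρ) x))
          (Prod.map ((Orb.mapPerm.comp ρ) x) ((Orb.mapPerm.comp ρ) x))) =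
      rdmEnergy h g₂ hnuc γ Γ := by
  simp only [MonoidHom.coe_comp, Function.comp_apply, Orb.mapPerm_apply]
  exact rdmEnergy_submatrix_mapEquiv h g₂ hnuc (ρ x) (hh x) (hg x) γ Γ

/-! ### The `S_z`-sector programme under an orbital symmetry group -/

/-- **The group average of a sector-feasible pair is sector-feasible** for a group of ORBITAL
symmetries `ρ : G →* Equiv.Perm Λ` (lifted to the spin orbitals by `Orb.mapPerm`, spin preserved).
[cite: GatermannParrilo2004, §3 proof of Thm. 3.3] -/
theorem IsDQGFeasibleSector.average (ρ : G →* Equiv.Perm Λ) {a b : ℕ}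
    {γ : Matrix (Orb Λ) (Orb Λ) ℂ} {Γ : Matrix (Orb Λ × Orb Λ) (Orb Λ × Orb Λ) ℂ}
    (h : IsDQGFeasibleSector a b γ Γ) :
    IsDQGFeasibleSector a b
      (∑ g : G, (((Fintype.card G : ℝ)⁻¹ : ℝ) : ℂ) •
        γ.submatrix ((Orb.mapPerm.comp ρ) g) ((Orb.mapPerm.comp ρ) g))
      (∑ g : G, (((Fintype.card G : ℝ)⁻¹ : ℝ) : ℂ) •
        Γ.submatrix (Prod.map ((Orb.mapPerm.comp ρ) g) ((Orb.mapPerm.comp ρ) g))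
          (Prod.map ((Orb.mapPerm.comp ρ) g) ((Orb.mapPerm.comp ρ) g))) :=
  IsDQGFeasibleSector.sum_smul Finset.univ (fun _ => (Fintype.card G : ℝ)⁻¹)
    (fun _ _ => inv_nonneg.mpr (Nat.cast_nonneg _)) sum_card_inv_eq_one fun g _ => by
      simp only [MonoidHom.coe_comp, Function.comp_apply, Orb.mapPerm_apply]
      exact h.submatrix_mapEquiv (ρ g)

/-- **Theorem 3.3 for the `S_z`-sector programme `E_PQG(a, b)`**: if the integral tables are
invariant under an orbital symmetry group `ρ : G →* Equiv.Perm Λ`, then `c ≤ E_PQG(a, b)` iff `c`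
lies below the energy functional on the `ρ`-INVARIANT sector-feasible pairs (`a, b ≤ |Λ|`) — the
symmetry-adapted sector programme has the same value. [cite: GatermannParrilo2004, §3 Thm. 3.3] -/
theorem le_pqgSectorEnergy_iff_invariant (h : Λ → Λ → ℂ) (g₂ : Λ → Λ → Λ → Λ → ℂ) (hnuc : ℂ)
    {a b : ℕ} (ha : a ≤ Fintype.card Λ) (hb : b ≤ Fintype.card Λ) (ρ : G →* Equiv.Perm Λ)
    (hh : ∀ (x : G) p q, h (ρ x p) (ρ x q) = h p q)
    (hg : ∀ (x : G) p q r s, g₂ (ρ x p) (ρ x q) (ρ x r) (ρ x s) = g₂ p q r s) {c : ℝ} :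
    c ≤ pqgSectorEnergy h g₂ hnuc a b ↔
      ∀ γ Γ, IsDQGFeasibleSector a b γ Γ →
        (∀ x : G, γ.submatrix ((Orb.mapPerm.comp ρ) x) ((Orb.mapPerm.comp ρ) x) = γ ∧
            Γ.submatrix (Prod.map ((Orb.mapPerm.comp ρ) x) ((Orb.mapPerm.comp ρ) x))
              (Prod.map ((Orb.mapPerm.comp ρ) x) ((Orb.mapPerm.comp ρ) x)) = Γ) →
          c ≤ (rdmEnergy h g₂ hnuc γ Γ).re := by
  rw [le_pqgSectorEnergy_iff h g₂ hnuc ha hb]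
  constructor
  · intro hc γ Γ hf _
    exact hc γ Γ hf
  · intro hc γ Γ hf
    rw [← rdmEnergy_average h g₂ hnuc (Orb.mapPerm.comp ρ)
      (rdmEnergy_submatrix_mapPerm h g₂ hnuc ρ hh hg) γ Γ]
    exact hc _ _ (hf.average ρ) fun x =>
      ⟨average_one_submatrix _ _ γ x, average_two_submatrix _ _ Γ x⟩

/-- **The sector minimum `E_PQG(a, b)` is attained at a `ρ`-invariant sector-feasible pair**
(average a minimiser over the orbital symmetry group). [cite: GatermannParrilo2004, §3 Thm. 3.3] -/
theorem exists_invariant_isDQGFeasibleSector_rdmEnergy_eq_pqgSectorEnergy (h : Λ → Λ → ℂ)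
    (g₂ : Λ → Λ → Λ → Λ → ℂ) (hnuc : ℂ) {a b : ℕ} (ha : a ≤ Fintype.card Λ)
    (hb : b ≤ Fintype.card Λ) (ρ : G →* Equiv.Perm Λ)
    (hh : ∀ (x : G) p q, h (ρ x p) (ρ x q) = h p q)
    (hg : ∀ (x : G) p q r s, g₂ (ρ x p) (ρ x q) (ρ x r) (ρ x s) = g₂ p q r s) :
    ∃ γ Γ, IsDQGFeasibleSector a b γ Γ ∧
      (∀ x : G, γ.submatrix ((Orb.mapPerm.comp ρ) x) ((Orb.mapPerm.comp ρ) x) = γ ∧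
          Γ.submatrix (Prod.map ((Orb.mapPerm.comp ρ) x) ((Orb.mapPerm.comp ρ) x))
            (Prod.map ((Orb.mapPerm.comp ρ) x) ((Orb.mapPerm.comp ρ) x)) = Γ) ∧
        (rdmEnergy h g₂ hnuc γ Γ).re = pqgSectorEnergy h g₂ hnuc a b := by
  obtain ⟨γ, Γ, hf, hE0⟩ := exists_isDQGFeasibleSector_rdmEnergy_eq_pqgSectorEnergy h g₂ hnuc ha hb
  refine ⟨_, _, hf.average ρ,
    fun x => ⟨average_one_submatrix _ _ γ x, average_two_submatrix _ _ Γ x⟩, ?_⟩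
  rw [rdmEnergy_average h g₂ hnuc (Orb.mapPerm.comp ρ)
    (rdmEnergy_submatrix_mapPerm h g₂ hnuc ρ hh hg) γ Γ, hE0]

/-! ### The sector programme under a general sector-preserving relabelling group (spin flip included) -/

/-- **The group average of a sector-feasible pair, for any relabelling group that preserves the
sector set** (condition (i) as a hypothesis `hσ`): covers orbital symmetry groups
(`IsDQGFeasibleSector.submatrix_mapEquiv`) and, for `N_α = N_β`, groups containing the spin flip
(`IsDQGFeasibleSector.submatrix_spinSwap`). [cite: GatermannParrilo2004, §3 proof of Thm. 3.3] -/
theorem IsDQGFeasibleSector.average' (σ : G →* Equiv.Perm (Orb Λ)) {a b : ℕ}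
    (hσ : ∀ (g : G) (γ : Matrix (Orb Λ) (Orb Λ) ℂ) (Γ : Matrix (Orb Λ × Orb Λ) (Orb Λ × Orb Λ) ℂ),
      IsDQGFeasibleSector a b γ Γ →
        IsDQGFeasibleSector a b (γ.submatrix (σ g) (σ g))
          (Γ.submatrix (Prod.map (σ g) (σ g)) (Prod.map (σ g) (σ g))))
    {γ : Matrix (Orb Λ) (Orb Λ) ℂ} {Γ : Matrix (Orb Λ × Orb Λ) (Orb Λ × Orb Λ) ℂ}
    (h : IsDQGFeasibleSector a b γ Γ) :
    IsDQGFeasibleSector a b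
      (∑ g : G, (((Fintype.card G : ℝ)⁻¹ : ℝ) : ℂ) • γ.submatrix (σ g) (σ g))
      (∑ g : G, (((Fintype.card G : ℝ)⁻¹ : ℝ) : ℂ) •
        Γ.submatrix (Prod.map (σ g) (σ g)) (Prod.map (σ g) (σ g))) :=
  IsDQGFeasibleSector.sum_smul Finset.univ (fun _ => (Fintype.card G : ℝ)⁻¹)
    (fun _ _ => inv_nonneg.mpr (Nat.cast_nonneg _)) sum_card_inv_eq_one fun g _ => hσ g γ Γ h

/-- **Theorem 3.3 for `E_PQG(a, b)` under a general sector-preserving relabelling group** with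
invariant energy functional: `c ≤ E_PQG(a, b)` iff `c` lies below `E` on the `σ`-invariant
sector-feasible pairs. With `σ` generated by the spin flip `Orb.spinSwap` at `a = b` this is the
abstract form of the `M = 0` spin-flip quotient's losslessness. [cite: GatermannParrilo2004, §3 Thm. 3.3] -/
theorem le_pqgSectorEnergy_iff_invariant' (h : Λ → Λ → ℂ) (g₂ : Λ → Λ → Λ → Λ → ℂ) (hnuc : ℂ)
    {a b : ℕ} (ha : a ≤ Fintype.card Λ) (hb : b ≤ Fintype.card Λ) (σ : G →* Equiv.Perm (Orb Λ))
    (hσ : ∀ (g : G) (γ : Matrix (Orb Λ) (Orb Λ) ℂ) (Γ : Matrix (Orb Λ × Orb Λ) (Orb Λ × Orb Λ) ℂ),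
      IsDQGFeasibleSector a b γ Γ →
        IsDQGFeasibleSector a b (γ.submatrix (σ g) (σ g))
          (Γ.submatrix (Prod.map (σ g) (σ g)) (Prod.map (σ g) (σ g))))
    (hE : ∀ (g : G) (γ : Matrix (Orb Λ) (Orb Λ) ℂ) (Γ : Matrix (Orb Λ × Orb Λ) (Orb Λ × Orb Λ) ℂ),
      rdmEnergy h g₂ hnuc (γ.submatrix (σ g) (σ g))
          (Γ.submatrix (Prod.map (σ g) (σ g)) (Prod.map (σ g) (σ g))) = rdmEnergy h g₂ hnuc γ Γ)
    {c : ℝ} :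
    c ≤ pqgSectorEnergy h g₂ hnuc a b ↔
      ∀ γ Γ, IsDQGFeasibleSector a b γ Γ →
        (∀ g : G, γ.submatrix (σ g) (σ g) = γ ∧
            Γ.submatrix (Prod.map (σ g) (σ g)) (Prod.map (σ g) (σ g)) = Γ) →
          c ≤ (rdmEnergy h g₂ hnuc γ Γ).re := by
  rw [le_pqgSectorEnergy_iff h g₂ hnuc ha hb]
  constructor
  · intro hc γ Γ hf _
    exact hc γ Γ hf
  · intro hc γ Γ hf
    rw [← rdmEnergy_average h g₂ hnuc σ hE γ Γ]
    exact hc _ _ (hf.average' σ hσ) fun g =>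
      ⟨average_one_submatrix σ _ γ g, average_two_submatrix σ _ Γ g⟩

/-- **An invariant minimiser of `E_PQG(a, b)` under a general sector-preserving relabelling group.**
[cite: GatermannParrilo2004, §3 Thm. 3.3] -/
theorem exists_invariant_isDQGFeasibleSector_rdmEnergy_eq_pqgSectorEnergy' (h : Λ → Λ → ℂ)
    (g₂ : Λ → Λ → Λ → Λ → ℂ) (hnuc : ℂ) {a b : ℕ} (ha : a ≤ Fintype.card Λ)
    (hb : b ≤ Fintype.card Λ) (σ : G →* Equiv.Perm (Orb Λ))
    (hσ : ∀ (g : G) (γ : Matrix (Orb Λ) (Orb Λ) ℂ) (Γ : Matrix (Orb Λ × Orb Λ) (Orb Λ × Orb Λ) ℂ),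
      IsDQGFeasibleSector a b γ Γ →
        IsDQGFeasibleSector a b (γ.submatrix (σ g) (σ g))
          (Γ.submatrix (Prod.map (σ g) (σ g)) (Prod.map (σ g) (σ g))))
    (hE : ∀ (g : G) (γ : Matrix (Orb Λ) (Orb Λ) ℂ) (Γ : Matrix (Orb Λ × Orb Λ) (Orb Λ × Orb Λ) ℂ),
      rdmEnergy h g₂ hnuc (γ.submatrix (σ g) (σ g))
          (Γ.submatrix (Prod.map (σ g) (σ g)) (Prod.map (σ g) (σ g))) = rdmEnergy h g₂ hnuc γ Γ) :
    ∃ γ Γ, IsDQGFeasibleSector a b γ Γ ∧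
      (∀ g : G, γ.submatrix (σ g) (σ g) = γ ∧
          Γ.submatrix (Prod.map (σ g) (σ g)) (Prod.map (σ g) (σ g)) = Γ) ∧
        (rdmEnergy h g₂ hnuc γ Γ).re = pqgSectorEnergy h g₂ hnuc a b := by
  obtain ⟨γ, Γ, hf, hE0⟩ := exists_isDQGFeasibleSector_rdmEnergy_eq_pqgSectorEnergy h g₂ hnuc ha hb
  refine ⟨_, _, hf.average' σ hσ,
    fun g => ⟨average_one_submatrix σ _ γ g, average_two_submatrix σ _ Γ g⟩, ?_⟩
  rw [rdmEnergy_average h g₂ hnuc σ hE γ Γ, hE0]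

/-- **The spin flip preserves the `N_α = N_β` sector set and the energy**: condition (i)+(ii) for any
relabelling group each of whose elements acts either as a lifted integral-preserving orbital bijection
or as such a bijection followed by `Orb.spinSwap` is discharged elementwise by
`IsDQGFeasibleSector.submatrix_mapEquiv` / `submatrix_spinSwap` and `rdmEnergy_submatrix_mapEquiv` /
`_spinSwap`; here the pure spin-flip case `σ g ∈ {1, Orb.spinSwap}` at `a = b`.
[cite: GatermannParrilo2004, §3 Def. 3.1] -/
theorem IsDQGFeasibleSector.submatrix_spinSwap_self {a : ℕ} {γ : Matrix (Orb Λ) (Orb Λ) ℂ}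
    {Γ : Matrix (Orb Λ × Orb Λ) (Orb Λ × Orb Λ) ℂ} (h : IsDQGFeasibleSector a a γ Γ) :
    IsDQGFeasibleSector a a (γ.submatrix (Orb.spinSwap : Orb Λ ≃ Orb Λ) Orb.spinSwap)
      (Γ.submatrix (Prod.map (Orb.spinSwap : Orb Λ ≃ Orb Λ) Orb.spinSwap)
        (Prod.map (Orb.spinSwap : Orb Λ ≃ Orb Λ) Orb.spinSwap)) :=
  h.submatrix_spinSwap

/-! ### The `PQGT1T2′` programme: average and Theorem 3.3 -/

/-- **The group average of a `PQGT1T2′`-feasible pair is `PQGT1T2′`-feasible.**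
[cite: GatermannParrilo2004, §3 proof of Thm. 3.3] -/
theorem IsDQGT1T2PrimeFeasible.average (σ : G →* Equiv.Perm (Orb Λ)) {N : ℕ}
    {γ : Matrix (Orb Λ) (Orb Λ) ℂ} {Γ : Matrix (Orb Λ × Orb Λ) (Orb Λ × Orb Λ) ℂ}
    (h : IsDQGT1T2PrimeFeasible N γ Γ) :
    IsDQGT1T2PrimeFeasible N
      (∑ g : G, (((Fintype.card G : ℝ)⁻¹ : ℝ) : ℂ) • γ.submatrix (σ g) (σ g))
      (∑ g : G, (((Fintype.card G : ℝ)⁻¹ : ℝ) : ℂ) •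
        Γ.submatrix (Prod.map (σ g) (σ g)) (Prod.map (σ g) (σ g))) :=
  IsDQGT1T2PrimeFeasible.sum_smul Finset.univ (fun _ => (Fintype.card G : ℝ)⁻¹)
    (fun _ _ => inv_nonneg.mpr (Nat.cast_nonneg _)) sum_card_inv_eq_one fun g _ => h.submatrix (σ g)

/-- **Theorem 3.3 for `E_PQGT1T2′`**: under an energy-invariant relabelling group, `c ≤ E_PQGT1T2′`
iff `c` lies below `E` on the `σ`-invariant `PQGT1T2′`-feasible pairs (`N ≤ 2|Λ|`).
[cite: GatermannParrilo2004, §3 Thm. 3.3] -/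
theorem le_pqgT1T2pEnergy_iff_invariant (h : Λ → Λ → ℂ) (g₂ : Λ → Λ → Λ → Λ → ℂ) (hnuc : ℂ)
    {N : ℕ} (hN : N ≤ Fintype.card (Orb Λ)) (σ : G →* Equiv.Perm (Orb Λ))
    (hE : ∀ (g : G) (γ : Matrix (Orb Λ) (Orb Λ) ℂ) (Γ : Matrix (Orb Λ × Orb Λ) (Orb Λ × Orb Λ) ℂ),
      rdmEnergy h g₂ hnuc (γ.submatrix (σ g) (σ g))
          (Γ.submatrix (Prod.map (σ g) (σ g)) (Prod.map (σ g) (σ g))) = rdmEnergy h g₂ hnuc γ Γ)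
    {c : ℝ} :
    c ≤ pqgT1T2pEnergy h g₂ hnuc N ↔
      ∀ γ Γ, IsDQGT1T2PrimeFeasible N γ Γ →
        (∀ g : G, γ.submatrix (σ g) (σ g) = γ ∧
            Γ.submatrix (Prod.map (σ g) (σ g)) (Prod.map (σ g) (σ g)) = Γ) →
          c ≤ (rdmEnergy h g₂ hnuc γ Γ).re := by
  rw [pqgT1T2pEnergy, le_csInf_iff (pqgT1T2pEnergySet_bddBelow h g₂ hnuc N)
    (pqgT1T2pEnergySet_nonempty h g₂ hnuc hN)]
  constructor
  · intro hc γ Γ hf _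
    exact hc _ ⟨γ, Γ, hf, rfl⟩
  · rintro hc E ⟨γ, Γ, hf, rfl⟩
    rw [← rdmEnergy_average h g₂ hnuc σ hE γ Γ]
    exact hc _ _ (hf.average σ) fun g =>
      ⟨average_one_submatrix σ _ γ g, average_two_submatrix σ _ Γ g⟩

/-- **An invariant minimiser of `E_PQGT1T2′`.** [cite: GatermannParrilo2004, §3 Thm. 3.3] -/
theorem exists_invariant_isDQGT1T2PrimeFeasible_rdmEnergy_eq_pqgT1T2pEnergy (h : Λ → Λ → ℂ)
    (g₂ : Λ → Λ → Λ → Λ → ℂ) (hnuc : ℂ) {N : ℕ} (hN : N ≤ Fintype.card (Orb Λ))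
    (σ : G →* Equiv.Perm (Orb Λ))
    (hE : ∀ (g : G) (γ : Matrix (Orb Λ) (Orb Λ) ℂ) (Γ : Matrix (Orb Λ × Orb Λ) (Orb Λ × Orb Λ) ℂ),
      rdmEnergy h g₂ hnuc (γ.submatrix (σ g) (σ g))
          (Γ.submatrix (Prod.map (σ g) (σ g)) (Prod.map (σ g) (σ g))) = rdmEnergy h g₂ hnuc γ Γ) :
    ∃ γ Γ, IsDQGT1T2PrimeFeasible N γ Γ ∧
      (∀ g : G, γ.submatrix (σ g) (σ g) = γ ∧
          Γ.submatrix (Prod.map (σ g) (σ g)) (Prod.map (σ g) (σ g)) = Γ) ∧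
        (rdmEnergy h g₂ hnuc γ Γ).re = pqgT1T2pEnergy h g₂ hnuc N := by
  obtain ⟨γ, Γ, hf, hE0⟩ := exists_isDQGT1T2PrimeFeasible_rdmEnergy_eq_pqgT1T2pEnergy h g₂ hnuc hN
  refine ⟨_, _, hf.average σ, fun g => ⟨average_one_submatrix σ _ γ g, average_two_submatrix σ _ Γ g⟩, ?_⟩
  rw [rdmEnergy_average h g₂ hnuc σ hE γ Γ, hE0]

/-- Spin-preserving orbital relabellings preserve the three-index sector set.
[cite: GatermannParrilo2004, §3 Def. 3.1 (i)] -/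
theorem IsDQGT1T2PrimeFeasibleSector.submatrix_mapEquiv {a b : ℕ} {γ : Matrix (Orb Λ) (Orb Λ) ℂ}
    {Γ : Matrix (Orb Λ × Orb Λ) (Orb Λ × Orb Λ) ℂ} (h : IsDQGT1T2PrimeFeasibleSector a b γ Γ)
    (f : Λ ≃ Λ) :
    IsDQGT1T2PrimeFeasibleSector a b (γ.submatrix (Orb.mapEquiv f) (Orb.mapEquiv f))
      (Γ.submatrix (Prod.map (Orb.mapEquiv f) (Orb.mapEquiv f))
        (Prod.map (Orb.mapEquiv f) (Orb.mapEquiv f))) where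
  toIsDQGFeasibleSector := h.toIsDQGFeasibleSector.submatrix_mapEquiv f
  t1_psd := by
    rw [t1Map_submatrix]
    exact h.t1_psd.submatrix _
  t2Prime_psd := by
    rw [t2PrimeMap_submatrix]
    exact h.t2Prime_psd.submatrix _

/-- **The three-index sector set is convex.** [cite: GatermannParrilo2004, §3 proof of Thm. 3.3] -/
theorem IsDQGT1T2PrimeFeasibleSector.sum_smul {a b : ℕ} {α : Type*} (s : Finset α) (w : α → ℝ)
    (hw0 : ∀ x ∈ s, 0 ≤ w x) (hw1 : ∑ x ∈ s, w x = 1) {γ : α → Matrix (Orb Λ) (Orb Λ) ℂ}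
    {Γ : α → Matrix (Orb Λ × Orb Λ) (Orb Λ × Orb Λ) ℂ}
    (h : ∀ x ∈ s, IsDQGT1T2PrimeFeasibleSector a b (γ x) (Γ x)) :
    IsDQGT1T2PrimeFeasibleSector a b (∑ x ∈ s, ((w x : ℝ) : ℂ) • γ x)
      (∑ x ∈ s, ((w x : ℝ) : ℂ) • Γ x) := by
  have h3 := IsDQGT1T2PrimeFeasible.sum_smul s w hw0 hw1 fun x hx => (h x hx).isDQGT1T2PrimeFeasible
  exact
    { toIsDQGFeasibleSector :=
        IsDQGFeasibleSector.sum_smul s w hw0 hw1 fun x hx => (h x hx).toIsDQGFeasibleSector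
      t1_psd := h3.t1_psd
      t2Prime_psd := h3.t2Prime_psd }

/-- **The group average of a three-index sector-feasible pair**, for any relabelling group that
preserves that set. [cite: GatermannParrilo2004, §3 proof of Thm. 3.3] -/
theorem IsDQGT1T2PrimeFeasibleSector.average' (σ : G →* Equiv.Perm (Orb Λ)) {a b : ℕ}
    (hσ : ∀ (g : G) (γ : Matrix (Orb Λ) (Orb Λ) ℂ) (Γ : Matrix (Orb Λ × Orb Λ) (Orb Λ × Orb Λ) ℂ),
      IsDQGT1T2PrimeFeasibleSector a b γ Γ →
        IsDQGT1T2PrimeFeasibleSector a b (γ.submatrix (σ g) (σ g))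
          (Γ.submatrix (Prod.map (σ g) (σ g)) (Prod.map (σ g) (σ g))))
    {γ : Matrix (Orb Λ) (Orb Λ) ℂ} {Γ : Matrix (Orb Λ × Orb Λ) (Orb Λ × Orb Λ) ℂ}
    (h : IsDQGT1T2PrimeFeasibleSector a b γ Γ) :
    IsDQGT1T2PrimeFeasibleSector a b
      (∑ g : G, (((Fintype.card G : ℝ)⁻¹ : ℝ) : ℂ) • γ.submatrix (σ g) (σ g))
      (∑ g : G, (((Fintype.card G : ℝ)⁻¹ : ℝ) : ℂ) •
        Γ.submatrix (Prod.map (σ g) (σ g)) (Prod.map (σ g) (σ g))) :=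
  IsDQGT1T2PrimeFeasibleSector.sum_smul Finset.univ (fun _ => (Fintype.card G : ℝ)⁻¹)
    (fun _ _ => inv_nonneg.mpr (Nat.cast_nonneg _)) sum_card_inv_eq_one fun g _ => hσ g γ Γ h

/-- **Theorem 3.3 for the sector value `E_PQGT1T2′(a, b)`** under a sector-preserving,
energy-invariant relabelling group (`a, b ≤ |Λ|`). [cite: GatermannParrilo2004, §3 Thm. 3.3] -/
theorem le_pqgT1T2pSectorEnergy_iff_invariant (h : Λ → Λ → ℂ) (g₂ : Λ → Λ → Λ → Λ → ℂ)
    (hnuc : ℂ) {a b : ℕ} (ha : a ≤ Fintype.card Λ) (hb : b ≤ Fintype.card Λ)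
    (σ : G →* Equiv.Perm (Orb Λ))
    (hσ : ∀ (g : G) (γ : Matrix (Orb Λ) (Orb Λ) ℂ) (Γ : Matrix (Orb Λ × Orb Λ) (Orb Λ × Orb Λ) ℂ),
      IsDQGT1T2PrimeFeasibleSector a b γ Γ →
        IsDQGT1T2PrimeFeasibleSector a b (γ.submatrix (σ g) (σ g))
          (Γ.submatrix (Prod.map (σ g) (σ g)) (Prod.map (σ g) (σ g))))
    (hE : ∀ (g : G) (γ : Matrix (Orb Λ) (Orb Λ) ℂ) (Γ : Matrix (Orb Λ × Orb Λ) (Orb Λ × Orb Λ) ℂ),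
      rdmEnergy h g₂ hnuc (γ.submatrix (σ g) (σ g))
          (Γ.submatrix (Prod.map (σ g) (σ g)) (Prod.map (σ g) (σ g))) = rdmEnergy h g₂ hnuc γ Γ)
    {c : ℝ} :
    c ≤ pqgT1T2pSectorEnergy h g₂ hnuc a b ↔
      ∀ γ Γ, IsDQGT1T2PrimeFeasibleSector a b γ Γ →
        (∀ g : G, γ.submatrix (σ g) (σ g) = γ ∧
            Γ.submatrix (Prod.map (σ g) (σ g)) (Prod.map (σ g) (σ g)) = Γ) →
          c ≤ (rdmEnergy h g₂ hnuc γ Γ).re := by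
  rw [pqgT1T2pSectorEnergy, le_csInf_iff (pqgT1T2pSectorEnergySet_bddBelow h g₂ hnuc a b)
    (pqgT1T2pSectorEnergySet_nonempty h g₂ hnuc ha hb)]
  constructor
  · intro hc γ Γ hf _
    exact hc _ ⟨γ, Γ, hf, rfl⟩
  · rintro hc E ⟨γ, Γ, hf, rfl⟩
    rw [← rdmEnergy_average h g₂ hnuc σ hE γ Γ]
    exact hc _ _ (hf.average' σ hσ) fun g =>
      ⟨average_one_submatrix σ _ γ g, average_two_submatrix σ _ Γ g⟩

/-- **An invariant minimiser of `E_PQGT1T2′(a, b)`.** [cite: GatermannParrilo2004, §3 Thm. 3.3] -/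
theorem exists_invariant_isDQGT1T2PrimeFeasibleSector_rdmEnergy_eq_pqgT1T2pSectorEnergy
    (h : Λ → Λ → ℂ) (g₂ : Λ → Λ → Λ → Λ → ℂ) (hnuc : ℂ) {a b : ℕ} (ha : a ≤ Fintype.card Λ)
    (hb : b ≤ Fintype.card Λ) (σ : G →* Equiv.Perm (Orb Λ))
    (hσ : ∀ (g : G) (γ : Matrix (Orb Λ) (Orb Λ) ℂ) (Γ : Matrix (Orb Λ × Orb Λ) (Orb Λ × Orb Λ) ℂ),
      IsDQGT1T2PrimeFeasibleSector a b γ Γ →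
        IsDQGT1T2PrimeFeasibleSector a b (γ.submatrix (σ g) (σ g))
          (Γ.submatrix (Prod.map (σ g) (σ g)) (Prod.map (σ g) (σ g))))
    (hE : ∀ (g : G) (γ : Matrix (Orb Λ) (Orb Λ) ℂ) (Γ : Matrix (Orb Λ × Orb Λ) (Orb Λ × Orb Λ) ℂ),
      rdmEnergy h g₂ hnuc (γ.submatrix (σ g) (σ g))
          (Γ.submatrix (Prod.map (σ g) (σ g)) (Prod.map (σ g) (σ g))) = rdmEnergy h g₂ hnuc γ Γ) :
    ∃ γ Γ, IsDQGT1T2PrimeFeasibleSector a b γ Γ ∧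
      (∀ g : G, γ.submatrix (σ g) (σ g) = γ ∧
          Γ.submatrix (Prod.map (σ g) (σ g)) (Prod.map (σ g) (σ g)) = Γ) ∧
        (rdmEnergy h g₂ hnuc γ Γ).re = pqgT1T2pSectorEnergy h g₂ hnuc a b := by
  obtain ⟨γ, Γ, hf, hE0⟩ :=
    exists_isDQGT1T2PrimeFeasibleSector_rdmEnergy_eq_pqgT1T2pSectorEnergy h g₂ hnuc ha hb
  refine ⟨_, _, hf.average' σ hσ,
    fun g => ⟨average_one_submatrix σ _ γ g, average_two_submatrix σ _ Γ g⟩, ?_⟩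
  rw [rdmEnergy_average h g₂ hnuc σ hE γ Γ, hE0]

end Reynolds

end Literature.MathematicalPhysics.QuantumChemistry

end
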